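/-
Copyright: rh-split cell (screw, prover seat l20 g3), 2026-08-27.  Splitting search over kernel-typed
RH-equivalences.  A splitting `A ∧ B ⟹ RH` is CONDITIONAL bookkeeping unless `A` and `B` are both
proved; nothing here bears on the truth of RH.
-/
import Summits.RiemannHypothesis.RiemannHypothesis.Theses.ScrewFabry
import HarnessLib

/-!
# Route X-16 `ScrewFabry` — the FABRY BRIDGE (item `FabryBridge`, stmt-RiemannHypothesis-23056, RH-free
given the named fact)

Objects of `ScrewLatticeContinuation` (row X-9) and `ScrewLatticePringsheim` (row X-15): step `h > 0`,
Suzuki's screw function `Ψ = zetaScrew`, the lattice generating function `P_h(z) = ∑_k Ψ(k h) z^k`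
(`latticeGF`; equal to the Borel series `B_h = ∑_ρ term (c_ρ) (u_ρ)` for `‖z‖ < e^{-h/2}`,
`latticeGF_eq_borel`), the aliased pole field `aliasedPoleSet h = poleSet (mult h)` with closure `T_h`
(the closed wall), and `CEIL(h) = LatticeCeiling h` (`|Ψ(k h)| ≤ K_ε e^{ε k}`).

**Theorem** (`fabryBridge_proof`, literally `Theses.ScrewFabry.FabryBridge`).  Assume the named
Fabry–Pólya fact `Theses.ScrewFabry.FabryFact` (Pringsheim form).  For `h > 0` and `Δ ≥ 0`: if the
NEGATIVE samples `Ψ(m h) < 0` have windowed density `≤ Δ/2`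
(`∀ r ∈ (0,1) ∀ ε > 0 ∃ T ∀ t ≥ T, #{m ∈ (t,(1+r)t] : Ψ(m h) < 0} ≤ (Δ/2 + ε) r t`) and the closed wall
`T_h` contains no point `z` of the sector `{‖z‖ < 1, |arg z| ≤ πΔ}`, then `CEIL(h)`.

Proof (the planner's two-layer plan (F1)–(F3), rh-idea-1 `Fabry_birth_pre.lean`).
* (F1) `ncard_signChange_le`: in every window the SIGN-CHANGE places of a real sequence `a` (Fabry's
  sense: `a k · a m < 0` for the previous non-zero index `k`) number at most
  `2 · #{negative places} + 1`: a change place `m` with `a m < 0` is itself a negative place; on the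
  change places with `a m > 0` the previous-index map `m ↦ k(m)` is injective with `a (k m) < 0`, and
  at most one of them has `k(m) ≤ t` (outside the window).  Hence (`signChangeDensity`) a windowed
  negative density `≤ Δ/2 + ε/3` gives a windowed sign-change density `≤ Δ + ε` once `ε r t ≥ 3`.
* (F2) `raySummable_of_fabryFact`: the fact applied with `a k = Ψ(k h)`, `F = B_h`, `b = 1`: the germ on
  `‖z‖ < e^{-h/2}` is `hasSum_latticeGF` + `latticeGF_eq_borel`; analyticity of `B_h` at each point of
  the sector is `ScrewBorel.differentiableOn_borel` on the open set `𝔻 ∖ T_h`, which contains the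
  sector by hypothesis.  Output: `∑ Ψ(k h) t^k` converges for every `t ∈ [0,1)`.
* (F3) `latticeCeiling_of_summable_ray`: at `t = e^{-ε}` the terms of a convergent series are bounded,
  `|Ψ(k h)| e^{-ε k} ≤ M`, i.e. `CEIL(h)`.

RH is not proved by this: `FabryBridge` is the RH-free leg (conditional on the cited fact `FabryFact`,
= `Literature.Analysis.Complex.FabrySignChanges`) of the CONDITIONAL splitting X-16
`FabryBridge ∧ SectorExchange ∧ FabryFact ∧ ThinWallOne ⟹ RH` (`SectorExchange`, `ThinWallOne` open,
RH-implied).  No `sorry`, no new axioms, no instances, no notation, no definitions.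
-/

set_option linter.dupNamespace false

namespace Summit.RiemannHypothesis.RiemannHypothesis.Theorems.ScrewFabry

open Complex Filter Topology Set Metric
open Literature.NumberTheory.LFunctions
open Summit.RiemannHypothesis.RiemannHypothesis.Theorems.Splittings
open Summit.RiemannHypothesis.RiemannHypothesis.Theorems.Splittings.ScrewBorel
open Summit.RiemannHypothesis.RiemannHypothesis.Theorems.Splittings.ScrewLatticeContinuation
open Summit.RiemannHypothesis.RiemannHypothesis.Theorems.Splittings.ScrewLatticePringsheim

/-! ## (F1) Window combinatorics: sign-change places versus negative places -/

/-- The non-zero terms strictly between the previous index `k` and a sign-change place `m` do not exist: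
if `k < j < m`, `a j ≠ 0` and every index strictly between `k` and `m` carries a zero term — contradiction.
(Trivial bookkeeping used three times below.) -/
theorem false_of_gap {a : ℕ → ℝ} {k j m : ℕ} (hkj : k < j) (hjm : j < m) (hj : a j ≠ 0)
    (hgap : ∀ i : ℕ, k < i → i < m → a i = 0) : False :=
  hj (hgap j hkj hjm)

/-- **(F1) Sign changes are at most twice the negative places, plus one.**  For a real sequence `a` and a
window `t < m ≤ u` (`m ∈ ℕ`), the number of SIGN-CHANGE places `m` in the window (there is `k < m` with
`a k · a m < 0` and `a j = 0` for `k < j < m`) is at most `2 · #{m in the window : a m < 0} + 1`. -/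
theorem ncard_signChange_le (a : ℕ → ℝ) (t u : ℝ) :
    Set.ncard {m : ℕ | t < m ∧ (m : ℝ) ≤ u ∧
        ∃ k : ℕ, k < m ∧ a k * a m < 0 ∧ ∀ j : ℕ, k < j → j < m → a j = 0}
      ≤ 2 * Set.ncard {m : ℕ | t < m ∧ (m : ℝ) ≤ u ∧ a m < 0} + 1 := by
  classical
  -- everything lives below `⌈u⌉₊`
  have hfin : ∀ s : Set ℕ, (∀ m ∈ s, (m : ℝ) ≤ u) → s.Finite := fun s hs ↦
    (Set.finite_Iic ⌈u⌉₊).subset fun m hm ↦ by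
      have h1 : (m : ℝ) ≤ ⌈u⌉₊ := (hs m hm).trans (Nat.le_ceil u)
      exact_mod_cast h1
  set S : Set ℕ := {m : ℕ | t < m ∧ (m : ℝ) ≤ u ∧
      ∃ k : ℕ, k < m ∧ a k * a m < 0 ∧ ∀ j : ℕ, k < j → j < m → a j = 0} with hS
  set N : Set ℕ := {m : ℕ | t < m ∧ (m : ℝ) ≤ u ∧ a m < 0} with hN
  have hNfin : N.Finite := hfin N fun m hm ↦ hm.2.1
  -- the previous-index map
  let κ : ℕ → ℕ := fun m ↦
    if hm : ∃ k : ℕ, k < m ∧ a k * a m < 0 ∧ ∀ j : ℕ, k < j → j < m → a j = 0 then hm.choose else 0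
  have hκ : ∀ m ∈ S, κ m < m ∧ a (κ m) * a m < 0 ∧ ∀ j : ℕ, κ m < j → j < m → a j = 0 := by
    intro m hm
    have hex := hm.2.2
    have e : κ m = hex.choose := dif_pos hex
    rw [e]
    exact hex.choose_spec
  -- split the change places by the sign of `a m`
  set S₁ : Set ℕ := {m : ℕ | m ∈ S ∧ a m < 0} with hS₁
  set S₂ : Set ℕ := {m : ℕ | m ∈ S ∧ 0 < a m} with hS₂
  have hsub : S ⊆ S₁ ∪ S₂ := by
    intro m hm
    have hne : a m ≠ 0 := by
      intro h0
      have := (hκ m hm).2.1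
      rw [h0, mul_zero] at this
      exact lt_irrefl _ this
    rcases hne.lt_or_gt with h | h
    · exact Or.inl ⟨hm, h⟩
    · exact Or.inr ⟨hm, h⟩
  have hS₁N : S₁ ⊆ N := fun m hm ↦ ⟨hm.1.1, hm.1.2.1, hm.2⟩
  -- on `S₂` the previous index carries a negative term
  have hκneg : ∀ m ∈ S₂, a (κ m) < 0 := by
    intro m hm
    rcases mul_neg_iff.1 (hκ m hm.1).2.1 with ⟨-, h⟩ | ⟨h, -⟩
    · exact absurd hm.2 (not_lt.2 h.le)
    · exact h
  -- `κ` is injective on `S₂`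
  have hinj : Set.InjOn κ S₂ := by
    intro m₁ hm₁ m₂ hm₂ heq
    rcases lt_trichotomy m₁ m₂ with h | h | h
    · exact (false_of_gap (a := a) (heq ▸ (hκ m₁ hm₁.1).1) h hm₁.2.ne' (hκ m₂ hm₂.1).2.2).elim
    · exact h
    · exact (false_of_gap (a := a) (heq.symm ▸ (hκ m₂ hm₂.1).1) h hm₂.2.ne' (hκ m₁ hm₁.1).2.2).elim
  -- split `S₂` by whether the previous index lies in the window
  set S₂' : Set ℕ := {m : ℕ | m ∈ S₂ ∧ t < κ m} with hS₂'
  set S₂'' : Set ℕ := {m : ℕ | m ∈ S₂ ∧ (κ m : ℝ) ≤ t} with hS₂''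
  have hsub₂ : S₂ ⊆ S₂' ∪ S₂'' := fun m hm ↦
    (lt_or_ge t (κ m)).elim (fun h ↦ Or.inl ⟨hm, h⟩) (fun h ↦ Or.inr ⟨hm, h⟩)
  have himg : κ '' S₂' ⊆ N := by
    rintro _ ⟨m, hm, rfl⟩
    refine ⟨hm.2, ?_, hκneg m hm.1⟩
    have h1 : (κ m : ℝ) ≤ m := by exact_mod_cast (hκ m hm.1.1).1.le
    exact h1.trans hm.1.1.2.1
  have hone : S₂''.ncard ≤ 1 := by
    refine (Set.ncard_le_one (hfin S₂'' fun m hm ↦ hm.1.1.2.1)).2 fun m₁ hm₁ m₂ hm₂ ↦ ?_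
    rcases lt_trichotomy m₁ m₂ with h | h | h
    · refine (false_of_gap (a := a) ?_ h hm₁.1.2.ne' (hκ m₂ hm₂.1.1).2.2).elim
      exact_mod_cast hm₂.2.trans_lt hm₁.1.1.1
    · exact h
    · refine (false_of_gap (a := a) ?_ h hm₂.1.2.ne' (hκ m₁ hm₁.1.1).2.2).elim
      exact_mod_cast hm₁.2.trans_lt hm₂.1.1.1
  -- count
  have h2' : S₂'.ncard ≤ N.ncard := by
    rw [← (hinj.mono fun m hm ↦ hm.1).ncard_image]
    exact Set.ncard_le_ncard himg hNfin
  have hS₂fin : (S₂' ∪ S₂'').Finite :=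
    hfin _ fun m hm ↦ hm.elim (fun h ↦ h.1.1.2.1) (fun h ↦ h.1.1.2.1)
  have hS₁₂fin : (S₁ ∪ S₂).Finite :=
    hfin _ fun m hm ↦ hm.elim (fun h ↦ h.1.2.1) (fun h ↦ h.1.2.1)
  calc S.ncard ≤ (S₁ ∪ S₂).ncard := Set.ncard_le_ncard hsub hS₁₂fin
    _ ≤ S₁.ncard + S₂.ncard := Set.ncard_union_le _ _
    _ ≤ N.ncard + (S₂' ∪ S₂'').ncard :=
        add_le_add (Set.ncard_le_ncard hS₁N hNfin) (Set.ncard_le_ncard hsub₂ hS₂fin)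
    _ ≤ N.ncard + (S₂'.ncard + S₂''.ncard) := by gcongr; exact Set.ncard_union_le _ _
    _ ≤ N.ncard + (N.ncard + 1) := by gcongr
    _ = 2 * N.ncard + 1 := by ring

/-- **(F1′) Windowed densities.**  A windowed negative density `≤ Δ/2` (all `r ∈ (0,1)`, all `ε > 0`,
`t` large) gives a windowed sign-change density `≤ Δ` in Fabry's form — the hypothesis the fact consumes. -/
theorem signChangeDensity (a : ℕ → ℝ) (Δ : ℝ)
    (hneg : ∀ r : ℝ, 0 < r → r < 1 → ∀ ε : ℝ, 0 < ε → ∃ T : ℝ, ∀ t : ℝ, T ≤ t →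
      (Set.ncard {m : ℕ | t < m ∧ (m : ℝ) ≤ (1 + r) * t ∧ a m < 0} : ℝ) ≤ (Δ / 2 + ε) * (r * t)) :
    ∀ r : ℝ, 0 < r → r < 1 → ∀ ε : ℝ, 0 < ε → ∃ T : ℝ, ∀ t : ℝ, T ≤ t →
      (Set.ncard {m : ℕ | t < m ∧ (m : ℝ) ≤ (1 + r) * t ∧
          ∃ k : ℕ, k < m ∧ a k * a m < 0 ∧ ∀ j : ℕ, k < j → j < m → a j = 0} : ℝ) ≤ (Δ + ε) * (r * t) := by
  intro r hr0 hr1 ε hε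
  obtain ⟨T₀, hT₀⟩ := hneg r hr0 hr1 (ε / 3) (by positivity)
  refine ⟨max T₀ (3 / (ε * r)), fun t ht ↦ ?_⟩
  have ht₀ : T₀ ≤ t := (le_max_left _ _).trans ht
  have ht₁ : 3 / (ε * r) ≤ t := (le_max_right _ _).trans ht
  have hεr : 0 < ε * r := mul_pos hε hr0
  have h3 : 3 ≤ ε * r * t := by
    have := mul_le_mul_of_nonneg_left ht₁ hεr.le
    rwa [mul_div_cancel₀ _ hεr.ne'] at this
  have hcomb := ncard_signChange_le a t ((1 + r) * t)
  have hcombR : (Set.ncard {m : ℕ | t < m ∧ (m : ℝ) ≤ (1 + r) * t ∧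
        ∃ k : ℕ, k < m ∧ a k * a m < 0 ∧ ∀ j : ℕ, k < j → j < m → a j = 0} : ℝ)
      ≤ 2 * (Set.ncard {m : ℕ | t < m ∧ (m : ℝ) ≤ (1 + r) * t ∧ a m < 0} : ℝ) + 1 := by
    exact_mod_cast hcomb
  have hN := hT₀ t ht₀
  calc _ ≤ 2 * (Set.ncard {m : ℕ | t < m ∧ (m : ℝ) ≤ (1 + r) * t ∧ a m < 0} : ℝ) + 1 := hcombR
    _ ≤ 2 * ((Δ / 2 + ε / 3) * (r * t)) + 1 := by gcongr
    _ ≤ 2 * ((Δ / 2 + ε / 3) * (r * t)) + ε / 3 * (r * t) := by nlinarith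
    _ = (Δ + ε) * (r * t) := by ring

/-! ## (F2) The fact applied to the lattice generating function -/

/-- **(F2) Ray summability from the Fabry–Pólya fact.**  `h > 0`, `Δ ≥ 0`, Fabry-form sign-change
density `≤ Δ` of `(Ψ(k h))_k`, and a closed wall missing the sector `{‖z‖ < 1, |arg z| ≤ πΔ}`: the fact,
applied with `a k = Ψ(k h)`, `F = B_h` (the Borel series), `b = 1`, gives convergence of `∑ Ψ(k h) t^k`
for every `t ∈ [0,1)`. -/
theorem raySummable_of_fabryFact (hF : Theses.ScrewFabry.FabryFact) {h : ℝ} (hh : 0 < h) {Δ : ℝ}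
    (hΔ : 0 ≤ Δ)
    (hsc : ∀ r : ℝ, 0 < r → r < 1 → ∀ ε : ℝ, 0 < ε → ∃ T : ℝ, ∀ t : ℝ, T ≤ t →
      (Set.ncard {m : ℕ | t < m ∧ (m : ℝ) ≤ (1 + r) * t ∧
          ∃ k : ℕ, k < m ∧ zetaScrew (k * h) * zetaScrew (m * h) < 0 ∧
            ∀ j : ℕ, k < j → j < m → zetaScrew (j * h) = 0} : ℝ) ≤ (Δ + ε) * (r * t))
    (hsec : ∀ z : ℂ, ‖z‖ < 1 → |Complex.arg z| ≤ Real.pi * Δ → z ∉ closure (aliasedPoleSet h))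
    {t : ℝ} (ht0 : 0 ≤ t) (ht1 : t < 1) :
    Summable (fun k : ℕ ↦ zetaScrew (k * h) * t ^ k) := by
  -- the Borel sum
  set F : ℂ → ℂ := fun z ↦
    ∑' ρ : ZetaZeros.riemannZetaNontrivialZeros, term (coeff ρ) (mult h ρ) z with hF_def
  -- analyticity on the sector (an open neighbourhood: `𝔻 ∖ T_h`)
  have hFan : ∀ z : ℂ, ‖z‖ < 1 → |Complex.arg z| ≤ Real.pi * Δ → AnalyticAt ℂ F z := by
    intro z hz harg
    have hU : IsOpen (ball (0 : ℂ) 1 \ closure (poleSet (mult h))) :=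
      isOpen_ball.sdiff isClosed_closure
    have hzU : z ∈ ball (0 : ℂ) 1 \ closure (poleSet (mult h)) :=
      ⟨mem_ball_zero_iff.2 hz, hsec z hz harg⟩
    exact (differentiableOn_borel summable_norm_coeff (mult_ne_zero h)).analyticAt (hU.mem_nhds hzU)
  -- the germ on `‖z‖ < e^{-h/2}`
  have hgerm : ∃ ε : ℝ, 0 < ε ∧ ∀ z : ℂ, ‖z‖ < ε →
      HasSum (fun n : ℕ ↦ ((zetaScrew (n * h) : ℝ) : ℂ) * z ^ n) (F z) := by
    refine ⟨Real.exp (-(h / 2)), Real.exp_pos _, fun z hz ↦ ?_⟩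
    have e : F z = latticeGF h z := (latticeGF_eq_borel hh hz).symm
    rw [e]
    exact hasSum_latticeGF hh hz
  exact hF (fun k ↦ zetaScrew (k * h)) F 1 Δ one_pos hΔ hsc hFan hgerm t ht0 ht1

/-! ## (F3) From ray summability to the two-sided ceiling -/

/-- **(F3)**  If `∑ Ψ(k h) t^k` converges for every `t ∈ [0,1)` then `CEIL(h)`: at `t = e^{-ε}` the terms
of a convergent series are bounded, `|Ψ(k h)| ≤ M e^{ε k}`. -/
theorem latticeCeiling_of_summable_ray {h : ℝ}
    (H : ∀ t : ℝ, 0 ≤ t → t < 1 → Summable (fun k : ℕ ↦ zetaScrew (k * h) * t ^ k)) :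
    LatticeCeiling h := by
  intro ε hε
  set t : ℝ := Real.exp (-ε) with ht
  have ht0 : 0 ≤ t := (Real.exp_pos _).le
  have ht1 : t < 1 := Real.exp_lt_one_iff.2 (by linarith)
  have hs := H t ht0 ht1
  obtain ⟨M, hM⟩ := (Metric.isBounded_range_of_tendsto _ hs.tendsto_atTop_zero).exists_norm_le
  refine ⟨M, fun k ↦ ?_⟩
  have hk := hM _ (Set.mem_range_self k)
  rw [Real.norm_eq_abs, abs_mul, abs_of_nonneg (pow_nonneg ht0 k)] at hk
  have htk : t ^ k = Real.exp (-(ε * k)) := by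
    rw [ht, ← Real.exp_nat_mul]; ring_nf
  have e1 : Real.exp (-(ε * k)) * Real.exp (ε * k) = 1 := by
    rw [← Real.exp_add]; simp
  rw [htk] at hk
  calc |zetaScrew (k * h)| = |zetaScrew (k * h)| * Real.exp (-(ε * k)) * Real.exp (ε * k) := by
        rw [mul_assoc, e1, mul_one]
    _ ≤ M * Real.exp (ε * k) := mul_le_mul_of_nonneg_right hk (Real.exp_pos _).le

/-! ## The bridge -/

/-- **FABRY BRIDGE** — item `stmt-RiemannHypothesis-23056`, literally `Theses.ScrewFabry.FabryBridge`
(RH-free given the named Fabry–Pólya fact): for every step `h > 0` and rate `Δ ≥ 0`, a windowed density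
`≤ Δ/2` of the negative lattice samples of `Ψ` together with a closed wall missing the sector
`{‖z‖ < 1, |arg z| ≤ πΔ}` gives the two-sided lattice ceiling `CEIL(h)`. -/
theorem fabryBridge_proof : Theses.ScrewFabry.FabryBridge := by
  intro hF h hh Δ hΔ hneg hsec
  exact latticeCeiling_of_summable_ray fun t ht0 ht1 ↦
    raySummable_of_fabryFact hF hh hΔ (signChangeDensity (fun m ↦ zetaScrew (m * h)) Δ hneg) hsec ht0 ht1

end Summit.RiemannHypothesis.RiemannHypothesis.Theorems.ScrewFabry
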